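import Summits.ResolutionOfSingularities.ResolutionOfSingularities.Theorems.ShallowCutFrame

/-!
# MaxContactCutShallowCut («ShallowCut», slice 4/4) — the flat-cone exit `FlatConeExit`, proved on its landed letter

`decomp-res-lens-2`, generation 32 (RESIDUAL MODE node; lens «structural dichotomy, special vs generic»; critic row
228 window as fixed by ROW 235).  Host route `MaxContactCut`, item `MaxContactCut.RungOne`
(`stmt-ResolutionOfSingularities-29273`), wired BY NAME through the landed
`CuspX.closes : CuspGenericRung → CuspSpecialRung → RungOne` and the landed 15-binder discharge
`PinchTower.cuspGenericRung_of_engines` (among its binders `(hC : FlatConeExit)`).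
Lean namespace `…Theorems.ShallowCut` (new).

## Main results

* `flatConeExit_holds : FlatConeExit` — ENGINE (C) of `PinchCutClasses` (:383), VERBATIM and hypothesis-free: on a
  regular scheme `Y`, for an ideal sheaf `I`, `2 ≤ n` and a uniformly cone-shallow curve `η`
  (`IsUniformConeCurve I n η`: a curve point all of whose closed specialisations carry a cone-shallow frame
  `IsConeShallowAt I n η y` — `c = (c₀, …, c_d)` generating the curve prime, inert `v`, `spanFinrank 𝔪_y = d + 2`,
  a form `Φ` of degree `n` in `d` variables with coefficients in `𝔪_y`, `g ∈ (c)ⁿ⁺¹`,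
  `c₀ⁿ + Φ(c₁, …, c_d) + g ∈ I_y ⊆ (c)ⁿ`, and `ConeShallow 𝔭 v Φ n`: in every chart `j` and at every maximal
  `𝔑 ∋ v̄, U_j` of `(𝒪_y/𝔭)[U]` the dehomogenised `Φ̄` is not in `𝔑ⁿ`), the package `⟨I, [], n⟩` exits over
  `{y | η ⤳ y}` (`RelativeDeltaCut.PackageExitsOver`) — for EVERY `d` and every residue field.
* `cuspGenericRung_of_engines` — the landed `PinchTower.cuspGenericRung_of_engines` with `hC` discharged
  (14 engine binders left); `closes_of_engines` displays `MaxContactCut.RungOne` from the 14 engines and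
  `CuspX.CuspSpecialRung` via `CuspX.closes` (by name, nothing re-landed).

## The mechanism (one blow-up; properness + pointwise semicontinuity over the generic point)

The exit package is the single blow-up of the reduced curve `C₀ = V(𝓘_{closure {η}})`.  `C₀` is regular
(`isRegular_coneCurve_subscheme`) and lies in `supp (I, n)` (`cone_stalkIdeal_le`; at `η` by localisation along
`stalkSpecializes`), so `[C₀]` is weakly admissible with centres over the curve, and `Bl_{C₀} Y` is regular.
KEY INVARIANT (`coneInv_closed`, `coneInv_eta`): at EVERY point `x'` of the blow-up over the curve the controlled
transform `J' = (I𝒪 : 𝓘_Eⁿ)` satisfies `J' ⊄ 𝔪_{x'}ⁿ`; hence `ord_{x'} J' < n`, the order-`n` locus over the curve is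
EMPTY and the exit clause `ord = n → 2 ≤ τ` holds vacuously (`flatConeExit_holds`).
* Over a CLOSED point `y` (slice 2, `cone_chart`, at EVERY prime `𝔴` of a chart over `𝔪_y`): `σ f = tⁿ·χ(H)` with
  `H = e₀ⁿ + Φ^φ(e₁, …, e_d) + φ(c_j)·r` (homogeneity `Φ(t·e) = tⁿΦ(e)`); if `e₀ ∉ 𝔴` (the whole `c₀`-chart, and the
  generic branch of the `c_j`-charts) `H` is a unit because the coefficients of `Φ` lie in `𝔪_y`
  (`cone_num_not_mem`); if `e₀ ∈ 𝔴` and `J' ⊆ 𝔪ⁿ` then `s·H ∈ 𝔴ⁿ` for some `s ∉ 𝔴`, and along the quotient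
  dictionary `q : B ↠ (𝒪_y/𝔭)[T_i : i ≠ j]` (`chartQuotEquiv`), `q H = T₀ⁿ + Ψ`, Zariski–Nagata INSIDE THE REGULAR
  RING `(𝒪_y/𝔭)[T]` (`𝒪_y/𝔭` regular local since `c` is part of a regular system of parameters;
  `MvPolynomial.isRegularRing_of_isRegularRing`; `mem_pow_of_mul_mem_pow_of_le`) moves `T₀ⁿ + Ψ` into `𝔑'ⁿ` for a
  maximal `𝔑' ∋ v̄, T₀`, whence `Ψ ∈ 𝔑'ⁿ` — and along the rename equivalence `U_{j'} ↦ T₀, U_i ↦ T_{i+1}`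
  (`coneShallow_rename`) this is `dehomog j' Φ̄ ∈ 𝔑ⁿ`, excluded by `ConeShallow` (`cone_polar_absurd`).
* Over `η` (slice 3, `coneInv_eta`): the blow-up is PROPER (`IsBlowup.isProper`), so a point `x'` over `η`
  specialises to some `x''` over a closed point `y₀` of the curve (`TowerCut.exists_specializes_over`), and
  `J'_{x'} ⊆ 𝔪ⁿ` would persist at `x''` (`stalkIdeal_le_pow_of_specializes`, pointwise, hypothesis-free on the
  regular blow-up), contradicting the closed-point invariant at `x''`.

Sections (this slice): §7 the engine · §8 corollaries (§1–§3 = `Theorems/ShallowCutAlg`, §4–§5 =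
`Theorems/ShallowCutChart`, §6 = `Theorems/ShallowCutFrame`).  All statements are over the tree's landed definitions
(`PinchCut.FlatConeExit`, `IsUniformConeCurve`, `IsConeShallowAt`, `ConeShallow`, `dehomog`,
`RelativeDeltaCut.PackageExitsOver`, `curvePrime`, `CentreSeq`, `controlledTransform`, `tauAt`); no `Prop`-valued
definition, notation or instance is introduced.

Sources: [Hironaka1964] Ch. III §1 (`𝔭⁽ⁿ⁾ ⊆ 𝔪ⁿ`, the effect of a permissible blow-up); [Hironaka1967];
[CossartJannsenSaito2020] Ch. 2, Ch. 8; [CossartPiltant2008] Prop. 4.2 (a); [Matsumura1987] Thms. 14.2, 16.2, 19.3;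
[StacksProject, Tags 0804, 01W0, 0BIQ].
-/

open IsLocalRing
open Literature.AlgebraicGeometry.Resolution

namespace Summit.ResolutionOfSingularities.ResolutionOfSingularities.Theorems.ShallowCut

/-! ## §7  ENGINE (C): the curve blow-up alone is an exit package over a uniformly cone-shallow curve -/

section SchemeLevel

open CategoryTheory AlgebraicGeometry TopologicalSpace Topology
open Summit.ResolutionOfSingularities.ResolutionOfSingularities.Theorems
open Summit.ResolutionOfSingularities.ResolutionOfSingularities.Theorems.WeakOrderReduction
open Summit.ResolutionOfSingularities.ResolutionOfSingularities.Theorems.RelativeDeltaCut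
open Summit.ResolutionOfSingularities.ResolutionOfSingularities.Theorems.CurveLeafExit
open Summit.ResolutionOfSingularities.ResolutionOfSingularities.Theorems.PinchCut

variable {Y : Scheme.{0}}

/-- **ENGINE `FlatConeExit` — PROVED.**  On a regular scheme, a uniformly cone-shallow curve `cl{η}` of order
`n ≥ 2` has an exit package over it consisting of the curve blow-up ALONE: after it the controlled transform is not
inside `𝔪ⁿ` at any point over the curve — at the points over closed points by the chart law `cone_chart`
(Zariski–Nagata inside the regular ring `(𝒪_y/𝔭)[T]` against `ConeShallow`), at the points over `η` by properness and
pointwise semicontinuity — so the order-`n` locus over the curve is EMPTY and the exit clause holds vacuously.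
[folklore] -/
theorem flatConeExit_holds : FlatConeExit := by
  intro Y hY I n hn η hU hLN
  obtain ⟨hcurve, hcone⟩ := hU
  haveI : IsLocallyNoetherian Y := hLN
  -- a closed point of the curve
  obtain ⟨y₀, hy₀, hy₀η⟩ : ∃ y₀ : Y, η ⤳ y₀ ∧ y₀ ≠ η := by
    by_contra hcon
    push Not at hcon
    refine hcurve.1 ?_
    have hcl : closure ({η} : Set Y) = {η} := by
      refine Set.Subset.antisymm (fun y hy => ?_) subset_closure
      exact hcon y (specializes_iff_mem_closure.mpr hy)
    rw [← hcl]
    exact isClosed_closure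
  have hy₀c : IsClosed ({y₀} : Set Y) := hcurve.2 y₀ hy₀ hy₀η
  -- the curve centre `C₀ = 𝓘(cl{η})`
  set C0 : Y.IdealSheafData :=
    Scheme.IdealSheafData.vanishingIdeal (⟨closure ({η} : Set Y), isClosed_closure⟩ : Closeds Y) with hC0def
  have hC0supp : ∀ y : Y, y ∈ (C0.support : Set Y) ↔ η ⤳ y := fun y => by
    rw [hC0def, coe_support_vanishingIdeal, specializes_iff_mem_closure]
    rfl
  have hC0st : ∀ (y : Y) (h : η ⤳ y), stalkIdeal C0 y = curvePrime h := fun y h => by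
    rw [hC0def, stalkIdeal_vanishingIdeal_closure h]
    rfl
  have hC0reg : Scheme.IsRegular C0.subscheme := isRegular_coneCurve_subscheme hY I hcurve hcone
  have hsuppT : (C0.support : Set Y) ⊆ {y | η ⤳ y} := fun y hy => (hC0supp y).mp hy
  have hsuppM : (C0.support : Set Y) ⊆ (⟨I, [], n⟩ : MarkedIdeal Y).support := by
    intro y hy
    have h : η ⤳ y := (hC0supp y).mp hy
    rw [MarkedIdeal.mem_support_iff]
    change stalkIdeal I y ≤ maximalIdeal _ ^ n
    by_cases hyc : IsClosed ({y} : Set Y)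
    · obtain ⟨h', hle, hPm⟩ := cone_stalkIdeal_le I (hcone y h hyc)
      exact hle.trans (Ideal.pow_right_mono hPm n)
    · have hyη : y = η := by
        by_contra hne
        exact hyc (hcurve.2 y h hne)
      subst hyη
      obtain ⟨h', hle, -⟩ := cone_stalkIdeal_le I (hcone y₀ hy₀ hy₀c)
      rw [← stalkIdeal_map_stalkSpecializes I h']
      refine (Ideal.map_mono hle).trans ?_
      rw [Ideal.map_pow]
      exact Ideal.pow_right_mono Ideal.map_comap_le n
  -- the blow-up `Y₁ → Y` of the curve is regular; the invariant over the curve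
  haveI := CentreSeq.isLocallyNoetherian_blowup C0
  have hY₁ : Scheme.IsRegular ↑(blowup C0) :=
    IsBlowup.isRegular_of_isRegular_subscheme hY hC0reg (blowup.isBlowup C0)
  have hinv : ∀ x' : ↑(blowup C0), η ⤳ blowup.π C0 x' →
      ¬ stalkIdeal (controlledTransform (blowup.π C0) C0 I n) x' ≤ maximalIdeal _ ^ n := by
    intro x' hηx
    by_cases hcl : IsClosed ({blowup.π C0 x'} : Set Y)
    · exact coneInv_closed hY C0 I (by omega) hC0st x' (hcone _ hηx hcl)
    · have hπη : blowup.π C0 x' = η := by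
        by_contra hne
        exact hcl (hcurve.2 _ hηx hne)
      exact coneInv_eta hY C0 I (by omega) hy₀ hC0st hY₁ (hcone y₀ hy₀ hy₀c) x' hπη
  refine ⟨CentreSeq.cons C0 (CentreSeq.nil _), ⟨hsuppM, hC0reg, trivial⟩, ⟨hsuppT, trivial⟩, hY₁,
    fun x hx hord => ?_⟩
  exfalso
  have hηx : η ⤳ blowup.π C0 x := hx
  have hord' : ((n : ℕ) : ℕ∞) ≤ idealOrder (controlledTransform (blowup.π C0) C0 I n) x := by
    have h1 := le_of_eq hord.symm
    simpa [CentreSeq.transformMarked_cons, CentreSeq.transformMarked_nil] using h1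
  exact hinv x hηx ((le_idealOrder_iff _ x n).mp hord')

/-- (c1) The engine AGAINST THE LANDED LETTER, fully qualified: `PinchCut.FlatConeExit` (PinchCutClasses :383) by
`flatConeExit_holds` — definitional unfolding only, no binder. -/
example : _root_.Summit.ResolutionOfSingularities.ResolutionOfSingularities.Theorems.PinchCut.FlatConeExit :=
  flatConeExit_holds

end SchemeLevel

/-! ## §8  DISCHARGE COROLLARY: the landed 15-engine corollary `PinchTower.cuspGenericRung_of_engines` with the binder
`hC : FlatConeExit` removed BY NAME (14 engine binders left) -/

section Corollaries

open Summit.ResolutionOfSingularities.ResolutionOfSingularities.Theorems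
open Summit.ResolutionOfSingularities.ResolutionOfSingularities.Theorems.WeakOrderReduction
open Summit.ResolutionOfSingularities.ResolutionOfSingularities.Theorems.DeltaFaceCutClasses
open Summit.ResolutionOfSingularities.ResolutionOfSingularities.Theorems.RelativeDeltaCut
open Summit.ResolutionOfSingularities.ResolutionOfSingularities.Theorems.FaceFormCutClasses
open Summit.ResolutionOfSingularities.ResolutionOfSingularities.Theorems.CurveLeafExit
open Summit.ResolutionOfSingularities.ResolutionOfSingularities.Theorems.PinchCut
open Summit.ResolutionOfSingularities.ResolutionOfSingularities.Theorems.JetCut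
open Summit.ResolutionOfSingularities.ResolutionOfSingularities.Theorems.PurityCut
open Summit.ResolutionOfSingularities.ResolutionOfSingularities.Theorems.SplitCut
open Summit.ResolutionOfSingularities.ResolutionOfSingularities.Theorems.CylinderCut
open Summit.ResolutionOfSingularities.ResolutionOfSingularities.Theorems.CrossCut
open Summit.ResolutionOfSingularities.ResolutionOfSingularities.Theorems.DeepCrossCut
open Summit.ResolutionOfSingularities.ResolutionOfSingularities.Theorems.OddCrossCut
open Summit.ResolutionOfSingularities.ResolutionOfSingularities.Theorems.CuspCut
open Summit.ResolutionOfSingularities.ResolutionOfSingularities.Theses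

/-- **`CuspX.CuspGenericRung` FROM FOURTEEN ENGINES** — the landed `PinchTower.cuspGenericRung_of_engines`
(15 engine binders) with its binder `hC : FlatConeExit` DISCHARGED by `flatConeExit_holds`. [folklore] -/
theorem cuspGenericRung_of_engines (hV : VeryNearCutClasses.VeryNearExit) (hD : DeltaPackageExit)
    (hU : UniformCurvePackageExit) (hR : RelCurvePackageExit)
    (hGE : GrandExit) (hSE : SplitConeExit) (hJE : JetCylinderExit)
    (hX : MaxContactCut.MaxOrderThreefoldResolution) (hXE : CrossExit) (hDXE : DeepCrossExit) (hNE : NodeExit)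
    (hOXE : OddCrossExit) (hCuE : CuspExit) (hTaE : TameTwoExit) : CuspX.CuspGenericRung :=
  PinchTower.cuspGenericRung_of_engines hV hD hU hR flatConeExit_holds hGE hSE hJE hX hXE hDXE hNE hOXE hCuE hTaE

/-- **`MaxContactCut.RungOne` BY NAME from fourteen engines and the located residual `CuspX.CuspSpecialRung`**
(`CuspX.closes`, cited, not re-landed). [folklore] -/
theorem closes_of_engines (hV : VeryNearCutClasses.VeryNearExit) (hD : DeltaPackageExit)
    (hU : UniformCurvePackageExit) (hR : RelCurvePackageExit)
    (hGE : GrandExit) (hSE : SplitConeExit) (hJE : JetCylinderExit)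
    (hX : MaxContactCut.MaxOrderThreefoldResolution) (hXE : CrossExit) (hDXE : DeepCrossExit) (hNE : NodeExit)
    (hOXE : OddCrossExit) (hCuE : CuspExit) (hTaE : TameTwoExit) (hS : CuspX.CuspSpecialRung) :
    MaxContactCut.RungOne :=
  CuspX.closes (cuspGenericRung_of_engines hV hD hU hR hGE hSE hJE hX hXE hDXE hNE hOXE hCuE hTaE) hS

end Corollaries

end Summit.ResolutionOfSingularities.ResolutionOfSingularities.Theorems.ShallowCut
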